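/-
Copyright: the b2b-balaban cell (near-miss cell 7), T⁴-continuum fan-out, lineage t4-ne7b-p3 (node U5c LARGE-DEVIATION
member P3).  Released under the licence of the surrounding project.
-/
import Literature.MathematicalPhysics.QuantumFieldTheory.Balaban1983to89.T4PrintedShapeBanking
import Summits.QuantumFields.BalabanUV.T4Continuum.Support.SpaceTimeBanking

/-!
# Space-time Peierls ∕ Cramér route for NE7b — leaf A3b, first half: THE LIFETIME OF A LINEAGE IS PAID BY ITS EVENT
# WINDOWS (the structure-steps of a genealogy's history tree number at most `Σ_events W e`)

Summits-side support leaf of the T⁴-continuum cell (rung (B)+1 on a FINITE torus only; NOT infinite volume, NOT the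
mass gap, NOT the Clay statement; NOT a proof of the spine estimate NE7b).  Lineage `t4-ne7b-p3` (generation 2), node
U5c, skeleton `t4/skeletons/NE7b-t4-ne7b-p3.md` leaf A3b (volume accounting), row ST5.  [folklore] finite combinatorics
over the row's SHARED genealogy carrier `T4PersistenceDictionary.Gen` (lineage t4-ne7b-p1), imported BY NAME and not
modified; nothing is quoted from print and nothing printed is asserted; no `[cite:]` tag.

WHAT.  The CONTOUR route prices a space-time contour `𝒦` = the occupied cells, at every scale, of the lineage of ONE
final live component (skeleton A2b); its volume is the sum over the STRUCTURE-STEPS `(V, n)` of the lineage's history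
tree (each constituent region while bare, each renewed component, each merged component, at each step of its own
segment — exactly the enumeration of `T4PrintedShapeBanking.treeCost` ∕ `treeFloor`) of the number of cells `V`
occupies at step `n`.  The per-structure-step cell bound has the shape `cA · D_n(V) + cB` (a CONNECTED family of cubes
of tree length `d′` has `≤ 2^d(4d′ + 1)` cubes), so the volume splits into a SIZE part (file `SpaceTimeVolume`) and a
LIFETIME part `cB · #{structure-steps}`.  This file counts the structure-steps:
* §1 `treeSteps step G t` — the number of structure-steps of the history tree of `G` up to the cut `t` (the merger
  step of an event read by `step : ε → ℕ`; on the dictionary's events `PEv.step`), and the located side conditions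
  `StepsOK` it needs (a renewal after the root birth and no later than readiness; a merger inside both partners'
  lives) — implied by `T4PrintedShapeBanking.Consistent ∧ Gen.WF` (§3);
* §2 **`treeSteps_add_reach_le`**: `treeSteps G t + reach G ≤ Σ_{e ∈ events} W e + max t rootStep` for every cut
  `t ≤ reach` — so **`treeSteps_le_epochLen`**: the lifetime is at most the total window length `Σ W` (the ledger's
  `epochLen`): every structure alive at a step is charged to an open window of one of ITS OWN events, injectively
  (coexisting structures have disjoint event sets);
* §3 the dictionary instance (`stepsOK_of_consistent`) and a decided example.
Nothing here is an estimate of Bałaban's; the READING that identifies the contour's cells with the structure-steps'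
cells is the skeleton's A2b (displayed elsewhere).

HONEST DEPENDENCY (cell, verbatim): continuum YM on T⁴ ⇐ BetaPertH ∧ nine spine estimates (0/9 proved); BetaPertH ⇐
(D1) ∧ (D4) ∧ CAP+tail; G-an2-4 gates asym, D1 and NE2/3/4.  This file changes none of it.
-/

open Finset

namespace Summit.QuantumFields.BalabanUV.T4Continuum.SpaceTimePeierls

open Literature.MathematicalPhysics.QuantumFieldTheory.Balaban1983to89
open T4PersistenceDictionary T4BankedInduction

/-! ## §1 Structure-steps of the history tree and the located side conditions -/

section Steps

variable {ε : Type*}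

/-- **THE NUMBER OF STRUCTURE-STEPS** of the history tree of a genealogy up to the cut `t`: a bare region born at `j`
counts the steps `[j, t)`; a renewed component (appearing at `h + 1`) counts the old component's structure-steps up to
`min (h+1) t` plus its own steps `[h+1, t)`; a merged component (appearing at the merger step `step e`) counts both
partners' structure-steps up to `min (step e) t` plus its own steps `[step e, t)`.  (= `T4PrintedShapeBanking.treeFloor`
with unit floor.) [folklore] -/
def treeSteps (step : ε → ℕ) : Gen ε → ℕ → ℕ
  | Gen.born _ j, t => t - j
  | Gen.renew G _ h, t => treeSteps step G (min (h + 1) t) + (t - (h + 1))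
  | Gen.merge X Y e, t => treeSteps step X (min (step e) t) + treeSteps step Y (min (step e) t) + (t - step e)

/-- **THE LOCATED SIDE CONDITIONS** of the count: a renewal happens after the root birth and the renewed component
appears no later than the old reach (`rootStep ≤ h`, `h + 1 ≤ reach`); a merger step lies in both partners' pending
lives `[rootStep, reach)`.  Hereditary.  (Implied by the dictionary's `Consistent ∧ Gen.WF`, §3.) [folklore] -/
def StepsOK (step : ε → ℕ) (W : ε → ℕ) : Gen ε → Prop
  | Gen.born _ _ => True
  | Gen.renew G _ h => StepsOK step W G ∧ G.rootStep ≤ h ∧ h + 1 ≤ G.reach W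
  | Gen.merge X Y e => StepsOK step W X ∧ StepsOK step W Y ∧
      X.rootStep ≤ step e ∧ step e < X.reach W ∧ Y.rootStep ≤ step e ∧ step e < Y.reach W

end Steps

/-! ## §2 The lifetime is paid by the windows -/

section Lifetime

variable {ε : Type*} [DecidableEq ε]

/-- **THE LIFETIME INVARIANT**: along a genealogy satisfying the located side conditions and well-formed (events
distinct), for every cut `t ≤ reach`,
`treeSteps G t + reach G ≤ Σ_{e ∈ events} W e + max t rootStep`.
Births: `(t − j) + (j + W b) = W b + t`.  Renewal at `h` (`rootStep ≤ h < h + 1 ≤ reach G`): the old tree is cut at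
`h + 1 ≤ reach G` (induction), the new steps `[h+1, t)` and the new reach `h + 1 + W e` are paid by `W e`.  Merger at
`s` inside both lives: both partner trees are cut at `s`, releasing `(reach X − s) + (reach Y − s) > max reach − s`,
which pays the merged component's steps `[s, t)` up to the later reach; `W e` pays the rest. [folklore] -/
theorem treeSteps_add_reach_le {step : ε → ℕ} {W : ε → ℕ} :
    ∀ {G : Gen ε}, StepsOK step W G → G.WF W → ∀ {t : ℕ}, t ≤ G.reach W →
      treeSteps step G t + G.reach W ≤ (∑ e ∈ G.events, W e) + max t G.rootStep
  | Gen.born b j, _, _, t, ht => by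
      simp only [treeSteps, Gen.reach_born, Gen.events_born, sum_singleton, Gen.rootStep_born] at ht ⊢
      omega
  | Gen.renew G e h, hok, hW, t, ht => by
      simp only [StepsOK] at hok
      obtain ⟨hG, hrh, hh1⟩ := hok
      have hW' := hW
      simp only [Gen.WF] at hW'
      obtain ⟨hGW, he, -, -⟩ := hW'
      simp only [Gen.reach_renew] at ht
      have IH := treeSteps_add_reach_le hG hGW (t := min (h + 1) t) ((min_le_left _ _).trans hh1)
      simp only [treeSteps, Gen.reach_renew, Gen.events_renew, sum_insert he, Gen.rootStep_renew]
      omega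
  | Gen.merge X Y e, hok, hW, t, ht => by
      simp only [StepsOK] at hok
      obtain ⟨hX, hY, hx, hx', hy, hy'⟩ := hok
      have hW' := hW
      simp only [Gen.WF] at hW'
      obtain ⟨hXW, hYW, heX, heY, hXY, -, -⟩ := hW'
      simp only [Gen.reach_merge] at ht
      have IHX := treeSteps_add_reach_le hX hXW (t := min (step e) t) ((min_le_left _ _).trans hx'.le)
      have IHY := treeSteps_add_reach_le hY hYW (t := min (step e) t) ((min_le_left _ _).trans hy'.le)
      have he : e ∉ X.events ∪ Y.events := by simp [heX, heY]
      simp only [treeSteps, Gen.reach_merge, Gen.events_merge, sum_insert he, sum_union hXY, Gen.rootStep_merge]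
      omega

/-- **THE LIFETIME IS AT MOST THE TOTAL WINDOW LENGTH**: for every cut `t ≤ reach`,
`treeSteps G t ≤ Σ_{e ∈ events} W e` (`= epochLen` of the contour ledger `ledgerOfGen`). [folklore] -/
theorem treeSteps_le_epochLen {step : ε → ℕ} {W : ε → ℕ} {G : Gen ε} (hok : StepsOK step W G) (hW : G.WF W)
    {t : ℕ} (ht : t ≤ G.reach W) : treeSteps step G t ≤ ∑ e ∈ G.events, W e := by
  have h := treeSteps_add_reach_le hok hW ht
  have hr := rootStep_le_reach W G hW
  have : max t G.rootStep ≤ G.reach W := max_le ht hr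
  omega

/-- … in real form, against the ledger of the genealogy: `treeSteps ≤ (ledgerOfGen …).epochLen`. [folklore] -/
theorem treeSteps_le_epochLen_real {step : ε → ℕ} {W : ε → ℕ} {G : Gen ε} (hok : StepsOK step W G)
    (hW : G.WF W) {t : ℕ} (ht : t ≤ G.reach W) (cost : Gen ε → ℕ → ℝ) (credit : ε → ℝ) (vol fat : ℕ) :
    (treeSteps step G t : ℝ) ≤ ((ledgerOfGen W cost credit vol fat G).epochLen : ℝ) := by
  have h := treeSteps_le_epochLen hok hW ht
  show (treeSteps step G t : ℝ) ≤ ((∑ e ∈ G.events, W e : ℕ) : ℝ)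
  exact_mod_cast h

end Lifetime

/-! ## §3 The dictionary instance and a decided example -/

section Dictionary

open T4PrintedShapeBanking

/-- **ON THE DICTIONARY**: a `Consistent` well-formed genealogy of persistence events (renewal AT readiness, merger
inside both lives; `Gen.WF`: the renewal step follows the root birth) satisfies the located side conditions with the
merger step read off the event, `step := PEv.step`. [folklore] -/
theorem stepsOK_of_consistent {C : T4PrintedShapeBanking.Consts} {K : ℕ} {R : ℕ → ℕ} :
    ∀ {G : Gen PEv}, Consistent C K R G → G.WF (dictW R C.n₁) → StepsOK PEv.step (dictW R C.n₁) G
  | Gen.born _ _, _, _ => trivial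
  | Gen.renew G e h, hc, hW => by
      simp only [Consistent] at hc
      obtain ⟨hG, -, -, hr, -⟩ := hc
      simp only [Gen.WF] at hW
      obtain ⟨hGW, -, hh, -⟩ := hW
      exact ⟨stepsOK_of_consistent hG hGW, hh, hr.le⟩
  | Gen.merge X Y e, hc, hW => by
      simp only [Consistent] at hc
      obtain ⟨hX, hY, -, hx, hx', hy, hy', -⟩ := hc
      simp only [Gen.WF] at hW
      obtain ⟨hXW, hYW, -⟩ := hW
      exact ⟨stepsOK_of_consistent hX hXW, stepsOK_of_consistent hY hYW, hx, hx', hy, hy'⟩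

/-- Hence, on the dictionary, the lifetime of a consistent well-formed genealogy up to any cut `t ≤ reach` is at most
its total window length. [folklore] -/
theorem treeSteps_le_epochLen_of_consistent {C : T4PrintedShapeBanking.Consts} {K : ℕ} {R : ℕ → ℕ} {G : Gen PEv}
    (hc : Consistent C K R G) (hW : G.WF (dictW R C.n₁)) {t : ℕ} (ht : t ≤ G.reach (dictW R C.n₁)) :
    treeSteps PEv.step G t ≤ ∑ e ∈ G.events, dictW R C.n₁ e :=
  treeSteps_le_epochLen (stepsOK_of_consistent hc hW) hW ht

/-- DECIDED EXAMPLE (the dictionary's sanity genealogy `T4PersistenceDictionary.G₀ = merge (born 0 0) (born 1 1) 2`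
with windows `W₀ = (3, 4, 2)`, merger step read as `1`): reach `= max 3 5 + 2 = 7`; structure-steps up to the reach:
the region `0` on `[0, 1)`, the region `1` on `[1, 1)`, the merged component on `[1, 7)` — `1 + 0 + 6 = 7 ≤ 3 + 4 + 2`.
[folklore] -/
example : treeSteps (fun _ => 1) G₀ (G₀.reach W₀) = 7 ∧ (∑ e ∈ G₀.events, W₀ e) = 9 := by
  refine ⟨by decide, by decide⟩

end Dictionary

end Summit.QuantumFields.BalabanUV.T4Continuum.SpaceTimePeierls
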